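import Mathlib
import HarnessLib
import Summits.QuantumFields.YangMills.Theses.SqueezedSkewness

/-!
# LINE «SqueezedSkewness» — BIRTH SKELETON (BC3) of the deciding crux `SqueezedFactorisation` (stmt-QuantumFields-25917)

Crux workfile for `stmt-QuantumFields-19353` (`BalabanLadder.NT`, rung R2a); route `route-QuantumFields-SqueezedSkewness`
(ym-idea-6 g2, lens oqh).  Two registered stubs and the kernel-checked composition `SqueezedFactorisation_of`:

* `stub_shell` (M; geometry, provable now): for every femto radius `0 < ℓ ≤ 1/4` a non-negative, non-zero Schwartz SHELL `h`
  supported in the annulus `ℓ ≤ ‖x − e₀‖ ≤ 2ℓ` around the unit-height point `e₀`, invariant under the full hyperoctahedral group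
  `B₄` (signed coordinate permutations of `x − e₀`), together with the three disjointness facts for every bump `v` of radius
  `≤ ℓ/2` at `e₀` (`v ⟂ θv`, `θv ⟂ h`, `v ⟂ h`).  Why the symmetry: `B₄` has no invariant vector in `Sym²₀(ℝ⁴)` nor in the Weyl
  module `(2,0)⊕(0,2)`, so the shell average kills the spin-2 and (anti)self-dual dimension-4 channels of the lattice OPE
  `dens × dens`; `F·F̃` drops by parity, `𝟙` from connected functions — only the scalar `[G²]` channel survives
  (answering the rev-3 erratum of the crux idea `skewness-from-asymptotic-freedom`).
* `stub_squeezeOnShells` (XL; the content): for every compact simple `G`, faithful unitary `r`, unit map `a → 0⁺` there is a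
  femto radius `ℓ` such that for EVERY symmetric shell `h` of radius `ℓ` some bump radius `ρ ≤ ℓ/2` works: every non-negative bump
  `v ⊆ closedBall e₀ ρ` carrying a clause-(i) mirror floor satisfies `|Q3(v, θv, h) − σ·w·Q2(θv, v)| ≤ δ·w·Q2(θv, v)` eventually,
  with `w > 0`, `δ < 1`, `σ = ±1` (prediction: `σ = −1`, `w = κ′(ℓ)·Σ_shell h(u)/‖u‖⁴`, `κ′ = (b₀/2π²)ḡ⁴(ℓ)` — the
  scheme-independent β₀-logarithm of the gluonic Wilson coefficient `C₁^GG`, Zoller–Chetyrkin arXiv:1209.1516 eq. (20); all-order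
  perturbative existence of the OPE for gauge-invariant composites in Euclidean YM₄: Fröb–Holland arXiv:1603.08012 Thm 1).
  Why it might fail: β- and volume-UNIFORM remainder < 1 in a non-perturbative background is not in print (order-by-order only).
* BC5 rung (plan-only, not a stub of the composition): `stub_gaussianSqueeze` — the same squeezed identity for the composite `:φ²:`
  of the massless lattice Gaussian field, exact by Wick (`κ₃ = 8 Σ v θv h G G G`, fusion weight `4G(u)`), a model where the analogue
  of the crux is decidable and the analogue of S (non-Gaussianity) is false.

`lean check`: sorries ONLY in `stub_*`; `SqueezedFactorisation_of` is a real proof.  No summit is proved by this line.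
-/

namespace Summit.QuantumFields.YangMills.Cruxes.NT.SqueezedSkewness.Birth

open Literature.MathematicalPhysics.QuantumFieldTheory Literature.MathematicalPhysics.QuantumLattice Summit.QuantumFields.YangMills.Cruxes.OSLegsFromFemtoAndGap.DlrCollarTransfer Summit.QuantumFields.YangMills.Theses.SqueezedSkewness in
/-- stub (M, provable now): hyperoctahedrally symmetric non-negative Schwartz shells at every femto radius, with the
disjointness geometry for bumps of half the radius. [folklore] -/
theorem stub_shell : ∀ ℓ : ℝ, 0 < ℓ → ℓ ≤ 1 / 4 → ∃ h : SchwartzMap (EuclideanSpace ℝ (Fin 4)) ℝ, ((∀ x, 0 ≤ h x) ∧ tsupport (h : EuclideanSpace ℝ (Fin 4) → ℝ) ⊆ Metric.closedBall (EuclideanSpace.single (0 : Fin 4) (1 : ℝ)) (2 * ℓ) \ Metric.ball (EuclideanSpace.single (0 : Fin 4) (1 : ℝ)) ℓ ∧ (∀ T : EuclideanSpace ℝ (Fin 4) ≃ₗᵢ[ℝ] EuclideanSpace ℝ (Fin 4), (∀ i : Fin 4, ∃ j : Fin 4, ∃ ε : ℝ, (ε = 1 ∨ ε = -1) ∧ T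 (EuclideanSpace.single i (1 : ℝ)) = ε • EuclideanSpace.single j (1 : ℝ)) → ∀ u : EuclideanSpace ℝ (Fin 4), h ((EuclideanSpace.single (0 : Fin 4) (1 : ℝ)) + T u) = h ((EuclideanSpace.single (0 : Fin 4) (1 : ℝ)) + u)) ∧ (∃ x, h x ≠ 0)) ∧ (∀ v : SchwartzMap (EuclideanSpace ℝ (Fin 4)) ℝ, tsupport (v : EuclideanSpace ℝ (Fin 4) → ℝ) ⊆ Metric.closedBall (EuclideanSpace.single (0 : Fin 4) (1 : ℝ)) (ℓ / 2) → Disjoint (tsupport (v : EuclideanSpace ℝ (Fin 4) → ℝ)) (tsupport (thetaTest 4 v : EuclideanSpace ℝ (Fin 4) → ℝ)) ∧ Disjoint (tsupport (thetaTest 4 v : EuclideanSpace ℝ (Fin 4) → ℝ)) (tsupport (h : EuclideanSpace ℝ (Fin 4) → ℝ)) ∧ Disjoint (tsupport (v : EuclideanSpace ℝ (Fin 4) → ℝ)) (tsupport (h : EuclideanSpace ℝ (Fin 4) → ℝ))) := by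
  sorry

open Literature.MathematicalPhysics.QuantumFieldTheory Literature.MathematicalPhysics.QuantumLattice Summit.QuantumFields.YangMills.Cruxes.OSLegsFromFemtoAndGap.DlrCollarTransfer Summit.QuantumFields.YangMills.Theses.SqueezedSkewness in
/-- stub (XL, the content of the crux): squeezed factorisation of the third cumulant onto the mirror two-point function for
every symmetric shell of a small enough femto radius, in any unit carrying clause-(i) floors for small bumps. -/
theorem stub_squeezeOnShells : ∀ (G : Type) [Group G] [TopologicalSpace G] [IsTopologicalGroup G] [CompactSpace G], IsCompactSimpleLieGroup G → letI : MeasurableSpace G := borel G; haveI : BorelSpace G := ⟨rfl⟩; ∀ (r : LatticeRep G) (a : ℝ → ℝ), (∀ β, 0 < a β) → Filter.Tendsto a Filter.atTop (nhds 0) → ∃ ℓ : ℝ, 0 < ℓ ∧ ℓ ≤ 1 / 4 ∧ ∀ h : SchwartzMap (EuclideanSpace ℝ (Fin 4)) ℝ, ((∀ x, 0 ≤ h x) ∧ tsupport (h : EuclideanSpace ℝ (Fin 4) → ℝ) ⊆ Metric.closedBall (EuclideanSpace.single (0 : Fin 4) (1 : ℝ)) (2 * ℓ) \ Metric.ball (EuclideanSpace.single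 (0 : Fin 4) (1 : ℝ)) ℓ ∧ (∀ T : EuclideanSpace ℝ (Fin 4) ≃ₗᵢ[ℝ] EuclideanSpace ℝ (Fin 4), (∀ i : Fin 4, ∃ j : Fin 4, ∃ ε : ℝ, (ε = 1 ∨ ε = -1) ∧ T (EuclideanSpace.single i (1 : ℝ)) = ε • EuclideanSpace.single j (1 : ℝ)) → ∀ u : EuclideanSpace ℝ (Fin 4), h ((EuclideanSpace.single (0 : Fin 4) (1 : ℝ)) + T u) = h ((EuclideanSpace.single (0 : Fin 4) (1 : ℝ)) + u)) ∧ (∃ x, h x ≠ 0)) → ∃ ρ : ℝ, 0 < ρ ∧ ρ ≤ ℓ / 2 ∧ ∀ v : SchwartzMap (EuclideanSpace ℝ (Fin 4)) ℝ, (∀ x, 0 ≤ v x) → tsupport (v : EuclideanSpace ℝ (Fin 4) → ℝ) ⊆ Metric.closedBall (EuclideanSpace.single (0 : Fin 4) (1 : ℝ)) ρ → (∃ ε β₅ Λ₅ : ℝ, 0 < ε ∧ ∀ β : ℝ, β₅ ≤ β → ∀ L : ℕ, Λ₅ ≤ a β * L → ε ≤ Q2 G r β L (a β) (thetaTest 4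 v) v) → ∃ w δ σ : ℝ, 0 < w ∧ δ < 1 ∧ (σ = 1 ∨ σ = -1) ∧ ∃ β₆ Λ₆ : ℝ, ∀ β : ℝ, β₆ ≤ β → ∀ L : ℕ, Λ₆ ≤ a β * L → |Q3 G r β L (a β) v (thetaTest 4 v) h - σ * w * Q2 G r β L (a β) (thetaTest 4 v) v| ≤ δ * w * Q2 G r β L (a β) (thetaTest 4 v) v := by
  sorry

/-- COMPOSITION (kernel-checked, no sorry): the two stubs, BY NAME, give the route's deciding crux BY NAME. [folklore] -/
theorem SqueezedFactorisation_of :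
    Summit.QuantumFields.YangMills.Theses.SqueezedSkewness.SqueezedFactorisation := by
  intro G _ _ _ _ hG
  letI : MeasurableSpace G := borel G
  haveI : BorelSpace G := ⟨rfl⟩
  intro r a ha ha0
  obtain ⟨ℓ, hℓ, hℓ4, H⟩ := stub_squeezeOnShells G hG r a ha ha0
  obtain ⟨h, hshell, hdisj⟩ := stub_shell ℓ hℓ hℓ4
  obtain ⟨ρ, hρ, hρℓ, Hv⟩ := H h hshell
  refine ⟨ρ, hρ, fun v hv0 hball hfl => ?_⟩
  obtain ⟨d1, d2, d3⟩ := hdisj v (hball.trans (Metric.closedBall_subset_closedBall hρℓ))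
  obtain ⟨w, δ, σ, hw, hδ, hσ, β₆, Λ₆, hb⟩ := Hv v hv0 hball hfl
  exact ⟨h, d1, d2, d3, w, δ, σ, hw, hδ, hσ, β₆, Λ₆, hb⟩

end Summit.QuantumFields.YangMills.Cruxes.NT.SqueezedSkewness.Birth
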